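import Literature.AlgebraicGeometry.Resolution.SplittingLemmaHyperbolicPair
import HarnessLib

/-!
# The named fact `GreuelPfister2026HyperbolicPairSplits` is FALSE AS TYPED (counterexample over `ℚ`)

Topic `Literature/AlgebraicGeometry/Resolution`; proof-lane companion (theorems only, no `def`, no `sorry`) of
`Literature/AlgebraicGeometry/Resolution/SplittingLemmaHyperbolicPair.lean`, which vendors Greuel–Pfister,
*The splitting lemma in any characteristic* (J. Algebra 689 (2026) 610–628 = arXiv:2507.17078), Lemma 3.4 (case
`l = 1`) as the named fact `GreuelPfister2026HyperbolicPairSplits`, quantified over EVERY field `K : Type u`.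

## What the print says

Lemma 3.4 sits in §3 «Splitting Lemma in Characteristic 2», which opens (arXiv p. 9, first sentence of the section):
«In this section let `K` be a field of characteristic 2.»  The printed proof of Lemma 3.4 (loc. cit.: the coordinate
change `x₁ ↦ (1/b₁)(x₁ + g₂)`, `x₂ ↦ x₂ + (1/b₁)g₁`, iterated) removes the terms `x₁g₁ + x₂g₂` by CANCELLING them
against the cross terms of `(x₁ + g₂)(x₂ + g₁/b₁)`, and uses that the squares `a₁(x₁+g₂)²`, `a₂(x₂+g₁/b₁)²`
produce no new mixed terms — both steps are characteristic-2 phenomena (`y = −y`, `2 = 0`).  The sentence «Let `K`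
be any field» of Lemma 3.4 is therefore to be read inside the section's standing hypothesis — exactly as in the
section's main result, Theorem 3.5 (1), which reads «Let char(`K`) = 2. • Let `f ∈ 𝔪² ⊂ K[[x₁,…,xₙ]]`, `K` any field.»
in one breath: in §3 «any field» means an arbitrary (not necessarily perfect or quadratically closed, cf. Cor. 3.2)
field OF CHARACTERISTIC 2.  The carpet's module docstring («Lemma 3.4 is characteristic-free») over-generalises it,
and the typed `∀ (K : Type u) [Field K]` statement is false whenever the quadratic part is allowed to be degenerate
(`b² = 4ac`, possible only for `char K ≠ 2`; for `char K ≠ 2` and `b² ≠ 4ac` the displayed normal form IS reachable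
by the classical splitting lemma, so the degenerate case is the whole defect).

## The counterexample (`K = ℚ`, `n = 0`, `a = b = 1`, `c = 1/4`, `d` empty, `h = x₁³`)

With these data the quadratic part `x₀² + x₀x₁ + ¼x₁² = (x₀ + ½x₁)²` is degenerate, `h = x₁³ ∈ 𝔪³`, and the fact
asserts a `ℚ`-algebra automorphism `φ` of `ℚ⟦x₀,x₁⟧` and an `h′` all of whose monomials have exponent `0` in `x₀`
and in `x₁` and total degree `≥ 3` — there are no such monomials when `n = 0`, so `h′ = 0` — with
`φ(f) = C(1/1²)x₀² + x₀x₁ + C(1/4)x₁² = (x₀ + ½x₁)²`, a square.  Hence `f = (x₀ + ½x₁)² + x₁³ = (φ⁻¹(x₀ + ½x₁))²`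
would be a square in `ℚ⟦x₀,x₁⟧`.  Substituting `x₀ ↦ −½T`, `x₁ ↦ T` (Mathlib's `MvPowerSeries.substAlgHom`, a
`ℚ`-algebra map `ℚ⟦x₀,x₁⟧ → ℚ⟦T⟧`) kills `x₀ + ½x₁` and sends `f` to `T³`, which would be a square `s·s` in `ℚ⟦T⟧`:
impossible, since `order (s·s) = 2·order s` is even (`PowerSeries.order_mul`) while `order T³ = 3`.
(Invariantly: `f ∼ y² + x³` is an `A₂` point, of finite Tjurina number, while `(x₀+½x₁)²` has infinite Tjurina
number; the order-parity argument is the cheapest kernel-checkable obstruction.)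

## Contents (all `theorem`s)

* (private) `X_pow_three_ne_mul_self` — `T³` is not a square in `ℚ⟦T⟧`; `hasSubst_line`, `X_one_pow_three_mem_cube`,
  `eq_zero_of_pure_residual` — plumbing;
* (private) `subst_counterexample` — the substitution computation `f(−½T, T) = T³`;
* `SplittingLemmaHyperbolicPairCounterexample.target_eq_sq` — the target series is `(x₀ + ½x₁)²`;
* `not_greuelPfister2026HyperbolicPairSplits : ¬ GreuelPfister2026HyperbolicPairSplits.{0}` — the named fact is
  false (at universe `0`, witnessed by `ℚ`).

The characteristic-2 statement the print proves (and which the consumer named in the carpet, the `p = 2` conjunct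
of the route item `stmt-ResolutionOfSingularities-16884`, needs) is NOT affected by this counterexample; it is not
restated here (no new named fact in a proof-lane file, D-0026).  The carpet's `def` is left byte-identical; this file
records that nothing may be derived from a hypothesis `(h : GreuelPfister2026HyperbolicPairSplits)`.

References: [GreuelPfister2026] G.-M. Greuel, G. Pfister, *The splitting lemma in any characteristic*, J. Algebra
689 (2026) 610–628, arXiv:2507.17078: §3 first sentence (p. 9), Lemma 3.4 and its proof (p. 9).
-/

noncomputable section

open MvPowerSeries

namespace Literature.AlgebraicGeometry.Resolution

namespace SplittingLemmaHyperbolicPairCounterexample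

/-- `T³` is not a square in `ℚ⟦T⟧`: orders add under multiplication over a domain, and `3` is odd. [folklore] -/
private theorem X_pow_three_ne_mul_self (s : PowerSeries ℚ) : (PowerSeries.X : PowerSeries ℚ) ^ 3 ≠ s * s := by
  intro h
  have ho := congrArg PowerSeries.order h
  rw [PowerSeries.order_X_pow, PowerSeries.order_mul] at ho
  by_cases hs : s = 0
  · subst hs
    simp at ho
  · have hne : s.order ≠ ⊤ := by rwa [ne_eq, PowerSeries.order_eq_top]
    obtain ⟨n, hn⟩ := ENat.ne_top_iff_exists.mp hne
    rw [← hn] at ho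
    norm_cast at ho
    omega

/-- The substitution `x₀ ↦ −½T`, `x₁ ↦ T` is admissible (constant coefficients vanish). [folklore] -/
private theorem hasSubst_line :
    HasSubst (![-(C (1 / 2 : ℚ)) * X (), X ()] : Fin 2 → MvPowerSeries Unit ℚ) := by
  refine hasSubst_of_constantCoeff_zero fun s => ?_
  fin_cases s <;> simp

/-- The substitution `x₀ ↦ −½T`, `x₁ ↦ T` sends the counterexample series
`f = C1·x₀² + C1·x₀x₁ + C(1/4)·x₁² + (empty sum) + x₁³` (the fact's left-hand side at `K = ℚ`, `n = 0`, `a = b = 1`,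
`c = 1/4`, `h = x₁³`) to `T³`. [cite: GreuelPfister2026, Lemma 3.4 (arXiv:2507.17078 p. 9), shape of `f` with l = 1] -/
private theorem subst_counterexample :
    substAlgHom hasSubst_line
        (C (1 : ℚ) * X (0 : Fin (0 + 2)) ^ 2 + C (1 : ℚ) * X (0 : Fin (0 + 2)) * X (1 : Fin (0 + 2)) +
          C (1 / 4 : ℚ) * X (1 : Fin (0 + 2)) ^ 2 +
          (∑ j : Fin 0, C (Fin.elim0 j : ℚ) * (X (j.addNat 2) : MvPowerSeries (Fin (0 + 2)) ℚ) ^ 2) +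
          X (1 : Fin (0 + 2)) ^ 3 : MvPowerSeries (Fin (0 + 2)) ℚ) =
      (X () : MvPowerSeries Unit ℚ) ^ 3 := by
  have hC : ∀ r : ℚ, substAlgHom hasSubst_line (C r : MvPowerSeries (Fin (0 + 2)) ℚ) =
      (C r : MvPowerSeries Unit ℚ) := fun r => by
    have h1 : (C r : MvPowerSeries (Fin (0 + 2)) ℚ) = algebraMap ℚ _ r := by rw [c_eq_algebraMap]
    have h2 : (C r : MvPowerSeries Unit ℚ) = algebraMap ℚ _ r := by rw [c_eq_algebraMap]
    rw [h1, h2]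
    exact AlgHom.commutes _ r
  simp only [Finset.univ_eq_empty, Finset.sum_empty, add_zero, map_add, map_mul, map_pow, hC,
    substAlgHom_X]
  simp only [Matrix.cons_val_zero, Matrix.cons_val_one, map_one, one_mul]
  have h4 : (C (1 / 4 : ℚ) : MvPowerSeries Unit ℚ) = C (1 / 2 : ℚ) ^ 2 := by
    rw [← map_pow]; norm_num
  have key : (2 : MvPowerSeries Unit ℚ) * C (1 / 2 : ℚ) = 1 := by
    rw [show (2 : MvPowerSeries Unit ℚ) = C (2 : ℚ) from (map_ofNat C 2).symm, ← map_mul, ← map_one C]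
    norm_num
  rw [h4]
  linear_combination (C (1 / 2 : ℚ) * (X () : MvPowerSeries Unit ℚ) ^ 2) * key

/-- The fact's right-hand side at the counterexample data (with `h′ = 0`) is the square `(x₀ + ½x₁)²`.
[cite: GreuelPfister2026, Lemma 3.4 (arXiv:2507.17078 p. 9), target shape with a′ = a/b²] -/
theorem target_eq_sq :
    (C (1 / 1 ^ 2 : ℚ) * X (0 : Fin (0 + 2)) ^ 2 + X (0 : Fin (0 + 2)) * X (1 : Fin (0 + 2)) +
          C (1 / 4 : ℚ) * X (1 : Fin (0 + 2)) ^ 2 +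
          (∑ j : Fin 0, C (Fin.elim0 j : ℚ) * (X (j.addNat 2) : MvPowerSeries (Fin (0 + 2)) ℚ) ^ 2) +
          (0 : MvPowerSeries (Fin (0 + 2)) ℚ)) =
      (X (0 : Fin (0 + 2)) + C (1 / 2 : ℚ) * X (1 : Fin (0 + 2))) ^ 2 := by
  simp only [Finset.univ_eq_empty, Finset.sum_empty, add_zero, one_pow, div_one, map_one, one_mul]
  have h4 : (C (1 / 4 : ℚ) : MvPowerSeries (Fin (0 + 2)) ℚ) = C (1 / 2 : ℚ) ^ 2 := by
    rw [← map_pow]; norm_num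
  have key : (2 : MvPowerSeries (Fin (0 + 2)) ℚ) * C (1 / 2 : ℚ) = 1 := by
    rw [show (2 : MvPowerSeries (Fin (0 + 2)) ℚ) = C (2 : ℚ) from (map_ofNat C 2).symm, ← map_mul, ← map_one C]
    norm_num
  rw [h4]
  linear_combination (-(X (0 : Fin (0 + 2)) * X (1 : Fin (0 + 2)))) * key

/-- `x₁³ ∈ 𝔪³`: every monomial of `x₁³` with non-zero coefficient has total degree `≥ 3`. [folklore] -/
private theorem X_one_pow_three_mem_cube (m : Fin (0 + 2) →₀ ℕ)
    (hm : coeff m ((X (1 : Fin (0 + 2)) : MvPowerSeries (Fin (0 + 2)) ℚ) ^ 3) ≠ 0) :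
    3 ≤ m.sum (fun _ e => e) := by
  classical
  rw [coeff_X_pow] at hm
  split_ifs at hm with h
  · subst h
    simp [Finsupp.sum_single_index]
  · exact absurd rfl hm

/-- On two variables, a series whose non-zero monomials avoid `x₀` and `x₁` and have degree `≥ 3` is zero. [folklore] -/
private theorem eq_zero_of_pure_residual (h' : MvPowerSeries (Fin (0 + 2)) ℚ)
    (hh' : ∀ m : Fin (0 + 2) →₀ ℕ, coeff m h' ≠ 0 → 3 ≤ m.sum (fun _ e => e) ∧ m 0 = 0 ∧ m 1 = 0) :
    h' = 0 := by
  ext m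
  rw [map_zero]
  by_contra hne
  obtain ⟨h3, h0, h1⟩ := hh' m hne
  have hm : m = 0 := by
    ext i
    fin_cases i
    · simpa using h0
    · simpa using h1
  subst hm
  simp at h3

end SplittingLemmaHyperbolicPairCounterexample

open SplittingLemmaHyperbolicPairCounterexample in
/-- **`GreuelPfister2026HyperbolicPairSplits` is false as typed** (refutation at universe `0`, `K = ℚ`, `n = 0`,
`a = b = 1`, `c = 1/4`, `h = x₁³`): the typed statement quantifies over all fields, but [GreuelPfister2026, §3] carries
the standing hypothesis «`K` a field of characteristic 2», without which the degenerate case `b² = 4ac` is a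
counterexample (`(x₀+½x₁)² + x₁³` is not right equivalent to the square `(x₀+½x₁)²`).
[cite: GreuelPfister2026, §3 first sentence and Lemma 3.4 with proof (arXiv:2507.17078 p. 9)] -/
theorem not_greuelPfister2026HyperbolicPairSplits : ¬ GreuelPfister2026HyperbolicPairSplits.{0} := by
  intro H
  obtain ⟨φ, h', -, hh', hφ⟩ :=
    H ℚ 0 1 1 (1 / 4) Fin.elim0 ((X (1 : Fin (0 + 2))) ^ 3) one_ne_zero X_one_pow_three_mem_cube
  have h'0 : h' = 0 := eq_zero_of_pure_residual h' hh'
  rw [h'0, target_eq_sq] at hφ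
  -- `f = s²` with `s = φ⁻¹ (x₀ + ½ x₁)`
  have hf := congrArg φ.symm hφ
  rw [AlgEquiv.symm_apply_apply, map_pow] at hf
  -- substitute `x₀ ↦ −½T`, `x₁ ↦ T`
  have hπ := congrArg (substAlgHom hasSubst_line) hf
  rw [subst_counterexample, map_pow, pow_two] at hπ
  exact X_pow_three_ne_mul_self _ hπ

end Literature.AlgebraicGeometry.Resolution

end
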